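import Mathlib
import Summits.Ventures.HodgeRepro.Tier4.Line4.ArchApproxBump

/-!
# Tier4/Line4/ArchApproxEstimate — C-L4-ARCHAPPROX, part 2: the `archFactor` closeness estimate and the APPROXIMATE
IDENTITY theorem `archFactor (finf ⋆ e) γ₀ ≠ 0` for a suitable bump `e`

Blind re-derivation cell `pub-hodge-repro`, Tier 4 «prove the step» (README §9–§10), seat t4-L1-p1 (prover, LINE L1,
gen 4; the lead's (R-21) S14968 on crit-1's PRECISION 5, Line4 Entry 108 S14967; statements posted S14990).  Tree path
`lean/Summits/Ventures/HodgeRepro/Tier4/Line4/ArchApproxEstimate.lean`.  Mathlib-level; no literature.  Part 2 of 3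
(ArchApproxBump → ArchApproxEstimate → ArchApprox).

WHAT IS PROVED (every declaration sorry-free, axioms `[propext, Classical.choice, Quot.sound]`).
* the unit-character laws `chi'_one` / `chi'_inv` / `conj_chi'_inv` / `conj_chi'_inv_mul` / `conj_chi'_mul_inv` (used by
  part 3), `coe_torusInf'_mem_infinitePart`, `torusInf'ToInf κ = ⟨κ, _⟩ ∈ G_∞` for `κ ∈ T′_∞`, `continuous_torusInf'ToInf`.
* `norm_archFactor_sub_le` — if `‖F₁ − F₂‖ ≤ ε` on the set `{a⁻¹ γ₀ a′ : a ∈ T_∞, a′ ∈ T′_∞}` then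
  `‖archFactor F₁ − archFactor F₂‖ ≤ ε · ν(T_∞) · ν′(T′_∞)` (unit characters, compact tori, finite measures; the inner
  integrals are continuous parametric integrals, hence integrable, so the difference of the twisted double integrals
  is the twisted double integral of the difference).
* `exists_bump_archFactor_convInf_ne_zero` — APPROXIMATE IDENTITY: for `finf` continuous, a function of the
  archimedean coordinate only (`hinf`, = `IsArchCoeff.infOnly` — needed: `finf ⋆ e` sees `finf` on `G_∞` only), with
  `archFactor finf γ₀ ≠ 0` there is a non-negative bump `e` (an `IsInfFactor`) with `archFactor (finf ⋆ e) γ₀ ≠ 0`.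
  Proof: uniform continuity of `finf` on the COMPACT set `{(a⁻¹ γ₀ a′)_∞}` along a neighbourhood `U` of `1` (the tube
  lemma `IsCompact.eventually_forall_of_forall_eventually`), the normalised bump in `U` (ArchApproxBump), the estimate
  `‖finf ⋆ e − finf‖ ≤ ε` there (`norm_convInf_sub_le`), then `norm_archFactor_sub_le` with
  `ε := ‖archFactor finf‖ / (2 (ν(T_∞) ν′(T′_∞) + 1))`.

HYPOTHESES (displayed on the lemmas, none on any target): `μ_∞` a Haar measure on `G_∞`; `ν`, `ν′` finite on the
COMPACT tori `T_∞`, `T′_∞` (`[CompactSpace (torusInf W)]`, `[CompactSpace (torusInf' W)]`); `χ`, `χ′` continuous unit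
characters (the wall's `hc hu hc' hunit'`); `finf` continuous and archimedean-only, `archFactor finf γ₀ ≠ 0`
(`IsArchCoeff.cont`, `.infOnly`, `.arch_ne`).  Junk: `finf = 0` is excluded by `hne`.

Nothing here says anything about the status of the Hodge conjecture for CM abelian varieties, which is NOT proved
(HC_CM is NOT proved by anyone in this repository).
-/

set_option autoImplicit false
noncomputable section
namespace Summit.Ventures.HodgeRepro.Tier4.Line4
open Summit.Ventures.HodgeRepro.Tier4 Summit.Ventures.HodgeRepro.Tier4.Common Summit.Ventures.HodgeRepro.Tier4.Line1
  Summit.Ventures.HodgeRepro.Tier4.Line4.L1Class MeasureTheory NumberField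
open scoped ComplexConjugate Topology Pointwise

section ArchApprox

variable {k : Type} [Field k] [NumberField k] (W : PlaneData k) [MeasurableSpace (GA W)] [BorelSpace (GA W)]

variable (R : RTFData W)

/-! ### Unit-character laws and the `G_∞`-points of `T′_∞` (used by parts 2 and 3) -/

omit [BorelSpace (GA W)] in
/-- a unit character takes the value `1` at `1`. -/
theorem chi'_one (hu' : ∀ a, ‖R.chi' a‖ = 1) : R.chi' 1 = 1 := by
  have h := R.chi'_mul 1 1
  rw [one_mul] at h
  have hne : R.chi' 1 ≠ 0 := by
    intro h0
    have := hu' 1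
    rw [h0, norm_zero] at this
    exact zero_ne_one this
  have : R.chi' 1 * R.chi' 1 = R.chi' 1 * 1 := by rw [mul_one]; exact h.symm
  exact mul_left_cancel₀ hne this

omit [BorelSpace (GA W)] in
/-- `χ′(a⁻¹) = (χ′ a)⁻¹` for a unit character. -/
theorem chi'_inv (hu' : ∀ a, ‖R.chi' a‖ = 1) (a : torusT' W) : R.chi' a⁻¹ = (R.chi' a)⁻¹ := by
  have h := R.chi'_mul a a⁻¹
  rw [mul_inv_cancel, chi'_one W R hu'] at h
  exact (eq_inv_of_mul_eq_one_right h.symm)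

omit [BorelSpace (GA W)] in
/-- `conj (χ′ a)⁻¹ = χ′ a` for a unit character. -/
theorem conj_chi'_inv (hu' : ∀ a, ‖R.chi' a‖ = 1) (a : torusT' W) : (conj (R.chi' a))⁻¹ = R.chi' a := by
  have h1 : conj (R.chi' a) * R.chi' a = 1 := by
    rw [mul_comm, Complex.mul_conj, Complex.normSq_eq_norm_sq, hu']
    simp
  exact inv_eq_of_mul_eq_one_right h1

omit [BorelSpace (GA W)] in
/-- the character law used by the projection: `conj χ′(κ⁻¹ κ′) = χ′(κ) · conj χ′(κ′)` for a unit character. -/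
theorem conj_chi'_inv_mul (hu' : ∀ a, ‖R.chi' a‖ = 1) (a b : torusT' W) :
    conj (R.chi' (a⁻¹ * b)) = R.chi' a * conj (R.chi' b) := by
  rw [R.chi'_mul, chi'_inv W R hu', map_mul, map_inv₀, conj_chi'_inv W R hu']

omit [BorelSpace (GA W)] in
/-- the character law for the right substitution: `conj χ′(b κ⁻¹) = conj χ′(b) · χ′(κ)`. -/
theorem conj_chi'_mul_inv (hu' : ∀ a, ‖R.chi' a‖ = 1) (b a : torusT' W) :
    conj (R.chi' (b * a⁻¹)) = conj (R.chi' b) * R.chi' a := by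
  rw [R.chi'_mul, chi'_inv W R hu', map_mul, map_inv₀, conj_chi'_inv W R hu']

omit [MeasurableSpace (GA W)] [BorelSpace (GA W)] in
/-- an element of `T′_∞` lies in `G_∞`. -/
theorem coe_torusInf'_mem_infinitePart (κ : torusInf' W) : ((κ : torusT' W) : GA W) ∈ infinitePart W :=
  Subgroup.mem_subgroupOf.1 κ.2

omit [MeasurableSpace (GA W)] [BorelSpace (GA W)] in
/-- `T′_∞` as a subset of `G_∞`: the element `⟨κ, _⟩`. -/
def torusInf'ToInf (κ : torusInf' W) : infinitePart W :=
  ⟨((κ : torusT' W) : GA W), coe_torusInf'_mem_infinitePart W κ⟩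

omit [MeasurableSpace (GA W)] [BorelSpace (GA W)] in
/-- `κ ↦ ⟨κ, _⟩ : T′_∞ → G_∞` is continuous. -/
theorem continuous_torusInf'ToInf : Continuous (torusInf'ToInf W) :=
  (continuous_subtype_val.comp continuous_subtype_val).subtype_mk _

/-- **the `archFactor` closeness estimate**: if `‖F₁ − F₂‖ ≤ ε` on the set `{a⁻¹ γ₀ a′}` then
`‖archFactor F₁ − archFactor F₂‖ ≤ ε · ν(T_∞) · ν′(T′_∞)` (unit characters, compact tori, finite measures). -/
theorem norm_archFactor_sub_le (νinf : Measure (torusInf W)) (νinf' : Measure (torusInf' W))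
    [IsFiniteMeasure νinf] [IsFiniteMeasure νinf'] [CompactSpace (torusInf W)] [CompactSpace (torusInf' W)]
    (hc : Continuous R.chi) (hu : ∀ a, ‖R.chi a‖ = 1) (hc' : Continuous R.chi') (hu' : ∀ a, ‖R.chi' a‖ = 1)
    {F₁ F₂ : GA W → ℂ} (h₁ : Continuous F₁) (h₂ : Continuous F₂) (γ₀ : GA W) {ε : ℝ}
    (hε : ∀ (a : torusInf W) (a' : torusInf' W),
      ‖F₁ (((a : torusT W) : GA W)⁻¹ * γ₀ * ((a' : torusT' W) : GA W)) -
        F₂ (((a : torusT W) : GA W)⁻¹ * γ₀ * ((a' : torusT' W) : GA W))‖ ≤ ε) :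
    ‖archFactor W R F₁ γ₀ νinf νinf' - archFactor W R F₂ γ₀ νinf νinf'‖ ≤
      ε * νinf.real Set.univ * νinf'.real Set.univ := by
  haveI := t2Space_GA W
  haveI := secondCountable_GA W
  haveI : SecondCountableTopology (torusT W) := Topology.IsEmbedding.subtypeVal.secondCountableTopology
  haveI : SecondCountableTopology (torusT' W) := Topology.IsEmbedding.subtypeVal.secondCountableTopology
  haveI : SecondCountableTopology (torusInf W) := Topology.IsEmbedding.subtypeVal.secondCountableTopology
  haveI : SecondCountableTopology (torusInf' W) := Topology.IsEmbedding.subtypeVal.secondCountableTopology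
  haveI : IsFiniteMeasureOnCompacts νinf := ⟨fun _ _ => measure_lt_top νinf _⟩
  haveI : IsFiniteMeasureOnCompacts νinf' := ⟨fun _ _ => measure_lt_top νinf' _⟩
  -- the point `a⁻¹ γ₀ a′` as a continuous function of `(a, a′)`
  let pt : torusInf W → torusInf' W → GA W := fun a a' =>
    ((a : torusT W) : GA W)⁻¹ * γ₀ * ((a' : torusT' W) : GA W)
  have hpt : Continuous (Function.uncurry pt) :=
    (((continuous_subtype_val.comp continuous_subtype_val).comp continuous_fst).inv.mul
      continuous_const).mul ((continuous_subtype_val.comp continuous_subtype_val).comp continuous_snd)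
  -- the inner integrals and their continuity in `a`
  let inner : (GA W → ℂ) → torusInf W → ℂ := fun F a =>
    ∫ a' : torusInf' W, conj (R.chi' (a' : torusT' W)) * F (pt a a') ∂νinf'
  have hinnerc : ∀ {F : GA W → ℂ}, Continuous F → Continuous (inner F) := by
    intro F hF
    have hunc : Continuous (Function.uncurry fun (a : torusInf W) (a' : torusInf' W) =>
        conj (R.chi' (a' : torusT' W)) * F (pt a a')) :=
      ((Complex.continuous_conj.comp (hc'.comp (continuous_subtype_val.comp continuous_snd))).mul
        (hF.comp hpt))
    have := continuous_parametric_integral_of_continuous hunc (isCompact_univ (X := torusInf' W))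
      (μ := νinf')
    simpa [Measure.restrict_univ] using this
  have hinner_int : ∀ {F : GA W → ℂ}, Continuous F → ∀ a : torusInf W,
      Integrable (fun a' : torusInf' W => conj (R.chi' (a' : torusT' W)) * F (pt a a')) νinf' := by
    intro F hF a
    have hcont : Continuous fun a' : torusInf' W => conj (R.chi' (a' : torusT' W)) * F (pt a a') :=
      (Complex.continuous_conj.comp (hc'.comp continuous_subtype_val)).mul
        (hF.comp (continuous_const.mul (continuous_subtype_val.comp continuous_subtype_val)))
    exact hcont.integrable_of_hasCompactSupport (HasCompactSupport.of_compactSpace _)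
  have houter_int : ∀ {F : GA W → ℂ}, Continuous F →
      Integrable (fun a : torusInf W => R.chi (a : torusT W) * inner F a) νinf := by
    intro F hF
    have hcont : Continuous fun a : torusInf W => R.chi (a : torusT W) * inner F a :=
      (hc.comp continuous_subtype_val).mul (hinnerc hF)
    exact hcont.integrable_of_hasCompactSupport (HasCompactSupport.of_compactSpace _)
  -- the inner difference bound
  have hinner_bound : ∀ a : torusInf W, ‖inner F₁ a - inner F₂ a‖ ≤ ε * νinf'.real Set.univ := by
    intro a
    have : inner F₁ a - inner F₂ a = ∫ a' : torusInf' W,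
        conj (R.chi' (a' : torusT' W)) * (F₁ (pt a a') - F₂ (pt a a')) ∂νinf' := by
      rw [← integral_sub (hinner_int h₁ a) (hinner_int h₂ a)]
      congr 1
      funext a'
      ring
    rw [this]
    apply norm_integral_le_of_norm_le_const
    refine Filter.Eventually.of_forall fun a' => ?_
    rw [norm_mul, Complex.norm_conj, hu', one_mul]
    exact hε a a'
  -- the outer bound
  have hdiff : archFactor W R F₁ γ₀ νinf νinf' - archFactor W R F₂ γ₀ νinf νinf' =
      ∫ a : torusInf W, R.chi (a : torusT W) * (inner F₁ a - inner F₂ a) ∂νinf := by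
    unfold archFactor
    rw [← integral_sub (houter_int h₁) (houter_int h₂)]
    congr 1
    funext a
    simp only [inner, pt]
    ring
  rw [hdiff]
  calc ‖∫ a : torusInf W, R.chi (a : torusT W) * (inner F₁ a - inner F₂ a) ∂νinf‖
      ≤ (ε * νinf'.real Set.univ) * νinf.real Set.univ := by
        apply norm_integral_le_of_norm_le_const
        refine Filter.Eventually.of_forall fun a => ?_
        rw [norm_mul, hu, one_mul]
        exact hinner_bound a
    _ = ε * νinf.real Set.univ * νinf'.real Set.univ := by ring


/-- **APPROXIMATE IDENTITY**: a non-zero archimedean factor survives convolution with a suitable bump.  For `finf`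
continuous with `archFactor finf γ₀ ≠ 0` there is an archimedean test factor `e` (a non-negative bump of integral `1`
supported near `1 ∈ G_∞`) with `archFactor (finf ⋆ e) γ₀ ≠ 0`, `finf ⋆ e = convInf μ_∞ finf e`. -/
theorem exists_bump_archFactor_convInf_ne_zero
    (μinf : Measure (infinitePart W)) [μinf.IsHaarMeasure]
    (νinf : Measure (torusInf W)) (νinf' : Measure (torusInf' W)) [IsFiniteMeasure νinf] [IsFiniteMeasure νinf']
    [CompactSpace (torusInf W)] [CompactSpace (torusInf' W)]
    (hc : Continuous R.chi) (hu : ∀ a, ‖R.chi a‖ = 1) (hc' : Continuous R.chi') (hu' : ∀ a, ‖R.chi' a‖ = 1)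
    {finf : GA W → ℂ} (hfinf : Continuous finf) (hinf : ∀ x, finf x = finf (GA.ofInfPart W x)) (γ₀ : GA W)
    (hne : archFactor W R finf γ₀ νinf νinf' ≠ 0) :
    ∃ e : GA W → ℂ, IsInfFactor W e ∧ archFactor W R (convInf W μinf finf e) γ₀ νinf νinf' ≠ 0 := by
  haveI := locallyCompact_infinitePart W
  haveI := secondCountable_infinitePart W
  haveI := t2Space_GA W
  -- the compact set `K = {(a⁻¹ γ₀ a′)_∞ : a ∈ T_∞, a′ ∈ T′_∞} ⊆ G_∞`
  let pt : torusInf W × torusInf' W → GA W := fun p =>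
    ((p.1 : torusT W) : GA W)⁻¹ * γ₀ * ((p.2 : torusT' W) : GA W)
  have hpt : Continuous pt :=
    (((continuous_subtype_val.comp continuous_subtype_val).comp continuous_fst).inv.mul
      continuous_const).mul ((continuous_subtype_val.comp continuous_subtype_val).comp continuous_snd)
  set K : Set (infinitePart W) := (infOf W ∘ pt) '' Set.univ with hK
  have hKc : IsCompact K := isCompact_univ.image ((continuous_infOf W).comp hpt)
  -- the tolerance
  set M : ℝ := νinf.real Set.univ * νinf'.real Set.univ with hM
  have hM0 : 0 ≤ M := mul_nonneg measureReal_nonneg measureReal_nonneg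
  have hnorm_pos : 0 < ‖archFactor W R finf γ₀ νinf νinf'‖ := norm_pos_iff.2 hne
  set ε : ℝ := ‖archFactor W R finf γ₀ νinf νinf'‖ / (2 * (M + 1)) with hε
  have hεpos : 0 < ε := div_pos hnorm_pos (by positivity)
  -- uniform continuity of `finf` on `K` along a neighbourhood of `1` (the tube lemma)
  have hev : ∀ᶠ u : infinitePart W in 𝓝 1, ∀ z ∈ K,
      ‖finf ((z : GA W) * (u : GA W)⁻¹) - finf z‖ < ε := by
    apply hKc.eventually_forall_of_forall_eventually
    intro z _
    have hcont : Continuous fun p : infinitePart W × infinitePart W =>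
        ‖finf ((p.2 : GA W) * (p.1 : GA W)⁻¹) - finf p.2‖ :=
      ((hfinf.comp ((continuous_subtype_val.comp continuous_snd).mul
        (continuous_subtype_val.comp continuous_fst).inv)).sub
        (hfinf.comp (continuous_subtype_val.comp continuous_snd))).norm
    have h0 : (fun p : infinitePart W × infinitePart W =>
        ‖finf ((p.2 : GA W) * (p.1 : GA W)⁻¹) - finf p.2‖) (1, z) < ε := by
      simp [hεpos]
    exact hcont.continuousAt.eventually_lt continuousAt_const h0
  obtain ⟨U, hU, hUev⟩ := hev.exists_mem
  obtain ⟨U', hU'U, hU'o, h1U'⟩ := mem_nhds_iff.1 hU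
  -- the bump, normalised
  obtain ⟨b, hb, hbc, hb0, hb1, hbU'⟩ := exists_bump_infinitePart W hU'o h1U'
  have hI := integral_bump_inv_pos W μinf hb hbc hb0 hb1
  set I : ℝ := ∫ y, b y⁻¹ ∂μinf with hIdef
  let b' : infinitePart W → ℝ := fun y => b y / I
  have hb' : Continuous b' := hb.div_const I
  have hb'c : HasCompactSupport b' := hbc.comp_left (g := fun t : ℝ => t / I) (zero_div I)
  have hb'0 : ∀ y, 0 ≤ b' y := fun y => div_nonneg (hb0 y) hI.le
  have hb'n : ∫ y, b' y⁻¹ ∂μinf = 1 := by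
    show ∫ y, b y⁻¹ / I ∂μinf = 1
    rw [integral_div, div_self hI.ne']
  have hb'U : ∀ y, y ∉ U' → b' y = 0 := fun y hy => by simp [b', hbU' y hy]
  let e : GA W → ℂ := fun x => ((b' (infOf W x) : ℝ) : ℂ)
  have he : IsInfFactor W e := by
    refine ⟨Complex.continuous_ofReal.comp (hb'.comp (continuous_infOf W)), fun x => ?_, ?_⟩
    · show ((b' (infOf W x) : ℝ) : ℂ) = ((b' (infOf W (GA.ofInfPart W x)) : ℝ) : ℂ)
      rw [← coe_infOf, infOf_coe]
    · have : (fun y : infinitePart W => e y) = fun y => ((b' y : ℝ) : ℂ) := by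
        funext y
        simp [e, infOf_coe]
      rw [this]
      exact hb'c.comp_left Complex.ofReal_zero
  refine ⟨e, he, ?_⟩
  -- the estimate on the compact set
  have hK' : ∀ z ∈ K, ∀ u ∈ U', ‖finf ((z : GA W) * (u : GA W)⁻¹) - finf z‖ ≤ ε :=
    fun z hz u hu => (hUev u (hU'U hu) z hz).le
  have hclose : ∀ (a : torusInf W) (a' : torusInf' W),
      ‖convInf W μinf finf e (((a : torusT W) : GA W)⁻¹ * γ₀ * ((a' : torusT' W) : GA W)) -
        finf (((a : torusT W) : GA W)⁻¹ * γ₀ * ((a' : torusT' W) : GA W))‖ ≤ ε := by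
    intro a a'
    rw [hinf (((a : torusT W) : GA W)⁻¹ * γ₀ * ((a' : torusT' W) : GA W))]
    exact norm_convInf_sub_le W μinf hfinf hb' hb'c hb'0 hb'n hb'U hK' (pt (a, a'))
      ⟨(a, a'), Set.mem_univ _, rfl⟩
  have hcont := continuous_convInf_of_isInfFactor W μinf hfinf he
  have hle := norm_archFactor_sub_le W R νinf νinf' hc hu hc' hu' hcont hfinf γ₀ hclose
  intro h0
  rw [h0, zero_sub, norm_neg] at hle
  have hεM : ε * νinf.real Set.univ * νinf'.real Set.univ ≤
      ‖archFactor W R finf γ₀ νinf νinf'‖ / 2 := by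
    rw [mul_assoc, ← hM, hε, div_mul_eq_mul_div, div_le_div_iff₀ (by positivity) (by norm_num)]
    nlinarith [hnorm_pos.le, hM0]
  linarith

end ArchApprox

end Summit.Ventures.HodgeRepro.Tier4.Line4

end
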